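import Summits.NavierStokesRegularity.NavierStokesRegularity.Theses.RellichScar
import Summits.NavierStokesRegularity.NavierStokesRegularity.Theorems.ScarRigidity.Negative.LogicAndLoadBearing
import Literature.Analysis.FluidPDE.TypeIAncientMild
import Literature.Analysis.FluidPDE.ParasiticSlabFlow
import Mathlib.Analysis.Calculus.MeanValue
import Mathlib.Topology.Order.MonotoneConvergence
import HarnessLib

/-!
# `ScarRigidity` — line `finite-energy-log-convexity`, stub `stub_apexDerivativeBounds`:
# the spatial limit of a function with cubically decaying gradient (crux stmt-NavierStokesRegularity-11717)

Helper file for S1β (pure calculus on `ℝ³`). If `g : ℝ³ → ℝ` is differentiable with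
`‖∇g(y)‖ ≤ L/(‖y‖ + a)³` (`L ≥ 0`, `a > 0`), then `g` has a limit `A` at spatial infinity and
`|g(x) - A| ≤ L/(2(‖x‖ + a)²)` for every `x` (`exists_limit_of_norm_fderiv_le`): along each ray
`s ↦ g(s u)`, `‖u‖ = 1`, the functions `g(su) ± L/(2(s+a)²)` are monotone (derivative test), so
the ray limits exist with the stated rate; two rays with `u + v ≠ 0` have the same limit (join
`su` and `sv` to the bisector direction, on which segments the gradient is `O(s⁻³)` while the
lengths are `O(s)`), and the antipodal ray is reached through a third direction. Applied
slice-wise to the pressure of S1β this produces the gauge `a(t) = lim_{|x|→∞} Q(t, x)` with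
`|Q(t,x) - a(t)| ≤ L/(2(‖x‖ + √(-t))²)`.
-/

noncomputable section

open Set Filter Function MeasureTheory Metric TopologicalSpace
open scoped Topology ENNReal NNReal InnerProductSpace RealInnerProductSpace
open Literature.Analysis.FluidPDE
open Summit.NavierStokesRegularity.NavierStokesRegularity.Theses.RellichScar
open Summit.NavierStokesRegularity.NavierStokesRegularity.Theorems.ScarRigidity.Negative

set_option linter.dupNamespace false

namespace Summit.NavierStokesRegularity.NavierStokesRegularity.Theorems.RellichScarScarRigidity

open Literature.Analysis

section Gauge

variable {g : (EuclideanSpace ℝ (Fin 3)) → ℝ} {L a : ℝ}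

/-! ## Rays -/

/-- **Ray comparison.** Along the ray `s ↦ g(s u)`, `‖u‖ = 1`, `0 ≤ s₁ ≤ s₂`:
`|g(s₂u) - g(s₁u)| ≤ L/(2(s₁+a)²) - L/(2(s₂+a)²)` (the functions `g(su) ± L/(2(s+a)²)` are
antitone/monotone on `[0, ∞)`: derivative test with `|∂ₛ g(su)| ≤ ‖∇g(su)‖ ≤ L/(s+a)³`). [folklore] -/
theorem abs_sub_le_of_ray (hg : Differentiable ℝ g) (ha : 0 < a)
    (hgrad : ∀ y : (EuclideanSpace ℝ (Fin 3)), ‖fderiv ℝ g y‖ ≤ L / (‖y‖ + a) ^ 3) {u : (EuclideanSpace ℝ (Fin 3))} (hu : ‖u‖ = 1)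
    {s₁ s₂ : ℝ} (h1 : 0 ≤ s₁) (h12 : s₁ ≤ s₂) :
    |g (s₂ • u) - g (s₁ • u)| ≤ L / (2 * (s₁ + a) ^ 2) - L / (2 * (s₂ + a) ^ 2) := by
  set r : ℝ → ℝ := fun s => g (s • u) with hr
  set Φ : ℝ → ℝ := fun s => L / 2 * ((s + a) * (s + a))⁻¹ with hΦ
  have hΦeq : ∀ s, 0 ≤ s → Φ s = L / (2 * (s + a) ^ 2) := by
    intro s hs
    have hsa : s + a ≠ 0 := by linarith
    rw [hΦ]; simp only; field_simp
  -- derivatives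
  have hr' : ∀ s, HasDerivAt r (fderiv ℝ g (s • u) u) s := by
    intro s
    have h1 : HasDerivAt (fun y : ℝ => y • u) ((1 : ℝ) • u) s := (hasDerivAt_id s).smul_const u
    rw [one_smul] at h1
    exact (hg (s • u)).hasFDerivAt.comp_hasDerivAt s h1
  have hΦ' : ∀ s, 0 ≤ s → HasDerivAt Φ (-(L / (s + a) ^ 3)) s := by
    intro s hs
    have hsa : s + a ≠ 0 := by linarith
    have h1 : HasDerivAt (fun s => (s + a) * (s + a)) (1 * (s + a) + (s + a) * 1) s :=
      ((hasDerivAt_id s).add_const a).mul ((hasDerivAt_id s).add_const a)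
    have h2 : HasDerivAt (fun s => ((s + a) * (s + a))⁻¹)
        (-(1 * (s + a) + (s + a) * 1) / ((s + a) * (s + a)) ^ 2) s :=
      h1.inv (mul_ne_zero hsa hsa)
    have h3 := h2.const_mul (L / 2)
    have e : -(L / (s + a) ^ 3) = L / 2 * (-(1 * (s + a) + (s + a) * 1) / ((s + a) * (s + a)) ^ 2) := by
      field_simp; ring
    rw [e]
    exact h3
  have hbound : ∀ s, 0 ≤ s → |fderiv ℝ g (s • u) u| ≤ L / (s + a) ^ 3 := by
    intro s hs
    have hn : ‖s • u‖ = s := by rw [norm_smul, Real.norm_of_nonneg hs, hu, mul_one]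
    calc |fderiv ℝ g (s • u) u| ≤ ‖fderiv ℝ g (s • u)‖ * ‖u‖ := by
          rw [← Real.norm_eq_abs]; exact ContinuousLinearMap.le_opNorm _ _
      _ ≤ L / (‖s • u‖ + a) ^ 3 * 1 := by rw [hu]; exact mul_le_mul_of_nonneg_right (hgrad _) zero_le_one
      _ = L / (s + a) ^ 3 := by rw [hn, mul_one]
  -- monotonicity on `[0, ∞)`
  have hD : Convex ℝ (Ici (0 : ℝ)) := convex_Ici 0
  have hint : interior (Ici (0 : ℝ)) = Ioi 0 := interior_Ici
  have hrc : Continuous r := by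
    have : ∀ s, HasDerivAt r (fderiv ℝ g (s • u) u) s := hr'
    exact continuous_iff_continuousAt.2 fun s => (this s).continuousAt
  have hΦc : ContinuousOn Φ (Ici 0) := by
    intro s hs
    refine ContinuousAt.continuousWithinAt ?_
    have hs0 : 0 < s + a := by linarith [mem_Ici.1 hs]
    have hsa : (s + a) * (s + a) ≠ 0 := by positivity
    exact continuousAt_const.mul
      (((continuousAt_id.add continuousAt_const).mul (continuousAt_id.add continuousAt_const)).inv₀ hsa)
  have hanti : AntitoneOn (fun s => r s + Φ s) (Ici 0) := by
    refine antitoneOn_of_deriv_nonpos hD (hrc.continuousOn.add hΦc) ?_ ?_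
    · rw [hint]; intro s hs
      exact ((hr' s).add (hΦ' s (le_of_lt hs))).differentiableAt.differentiableWithinAt
    · rw [hint]; intro s hs
      have hd := (hr' s).add (hΦ' s (le_of_lt hs))
      show deriv (r + Φ) s ≤ 0
      rw [hd.deriv]
      have := hbound s (le_of_lt hs)
      linarith [le_abs_self (fderiv ℝ g (s • u) u)]
  have hmono : MonotoneOn (fun s => r s - Φ s) (Ici 0) := by
    refine monotoneOn_of_deriv_nonneg hD (hrc.continuousOn.sub hΦc) ?_ ?_
    · rw [hint]; intro s hs
      exact ((hr' s).sub (hΦ' s (le_of_lt hs))).differentiableAt.differentiableWithinAt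
    · rw [hint]; intro s hs
      have hd := (hr' s).sub (hΦ' s (le_of_lt hs))
      show 0 ≤ deriv (r - Φ) s
      rw [hd.deriv]
      have := hbound s (le_of_lt hs)
      linarith [neg_abs_le (fderiv ℝ g (s • u) u)]
  have hs₂ : 0 ≤ s₂ := h1.trans h12
  have hA := hanti (mem_Ici.2 h1) (mem_Ici.2 hs₂) h12
  have hM := hmono (mem_Ici.2 h1) (mem_Ici.2 hs₂) h12
  simp only at hA hM
  rw [← hΦeq s₁ h1, ← hΦeq s₂ hs₂, abs_le]
  constructor <;> linarith

/-- **Ray limits with a rate.** Along every unit ray the limit `A_u = lim_{s→∞} g(su)` exists and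
`|g(su) - A_u| ≤ L/(2(s+a)²)` for `s ≥ 0`. [folklore] -/
theorem exists_ray_limit (hg : Differentiable ℝ g) (hL : 0 ≤ L) (ha : 0 < a)
    (hgrad : ∀ y : (EuclideanSpace ℝ (Fin 3)), ‖fderiv ℝ g y‖ ≤ L / (‖y‖ + a) ^ 3) {u : (EuclideanSpace ℝ (Fin 3))} (hu : ‖u‖ = 1) :
    ∃ A : ℝ, Tendsto (fun s : ℝ => g (s • u)) atTop (𝓝 A) ∧
      ∀ s : ℝ, 0 ≤ s → |g (s • u) - A| ≤ L / (2 * (s + a) ^ 2) := by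
  set Φ : ℝ → ℝ := fun s => L / (2 * (s + a) ^ 2) with hΦ
  have hΦ0 : ∀ s, 0 ≤ s → 0 ≤ Φ s := fun s hs => by rw [hΦ]; positivity
  -- the monotone minorant `h(s) = g(su) - Φ(s)` on `[0, ∞)`, made global by `max s 0`
  set H : ℝ → ℝ := fun s => g (max s 0 • u) - Φ (max s 0) with hH
  have hray := fun (s₁ s₂ : ℝ) (h1 : 0 ≤ s₁) (h12 : s₁ ≤ s₂) => abs_sub_le_of_ray hg ha hgrad hu h1 h12
  have hHmono : Monotone H := by
    intro s s' hss'
    have h0 : 0 ≤ max s 0 := le_max_right _ _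
    have hle : max s 0 ≤ max s' 0 := max_le_max hss' le_rfl
    have h := hray _ _ h0 hle
    rw [abs_le] at h
    show g (max s 0 • u) - Φ (max s 0) ≤ g (max s' 0 • u) - Φ (max s' 0)
    linarith [h.1]
  have hHbdd : BddAbove (range H) := by
    refine ⟨g ((0 : ℝ) • u) + Φ 0, ?_⟩
    rintro _ ⟨s, rfl⟩
    have h0 : 0 ≤ max s 0 := le_max_right _ _
    have h := hray 0 _ le_rfl h0
    rw [abs_le] at h
    show g (max s 0 • u) - Φ (max s 0) ≤ g ((0 : ℝ) • u) + Φ 0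
    linarith [h.2, hΦ0 _ h0]
  have hHt : Tendsto H atTop (𝓝 (⨆ s, H s)) := tendsto_atTop_ciSup hHmono hHbdd
  set A : ℝ := ⨆ s, H s with hA
  -- `Φ → 0`
  have hΦt : Tendsto Φ atTop (𝓝 0) := by
    have h1 : Tendsto (fun s : ℝ => 2 * (s + a) ^ 2) atTop atTop := by
      refine tendsto_atTop_mono' atTop ?_ tendsto_id
      filter_upwards [eventually_ge_atTop (1 : ℝ)] with s hs
      show s ≤ 2 * (s + a) ^ 2
      nlinarith
    exact tendsto_const_nhds.div_atTop h1
  -- `g(su) = H(s) + Φ(s)` for `s ≥ 0`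
  have heq : (fun s : ℝ => g (s • u)) =ᶠ[atTop] fun s => H s + Φ s := by
    filter_upwards [eventually_ge_atTop (0 : ℝ)] with s hs
    show g (s • u) = g (max s 0 • u) - Φ (max s 0) + Φ s
    rw [max_eq_left hs]; ring
  have hgt : Tendsto (fun s : ℝ => g (s • u)) atTop (𝓝 A) := by
    have := hHt.add hΦt
    rw [add_zero] at this
    exact this.congr' heq.symm
  refine ⟨A, hgt, fun s hs => ?_⟩
  -- the rate: `|g(s₂u) - g(su)| ≤ Φ(s)` for `s₂ ≥ s`, and `s₂ → ∞`
  have hev : ∀ᶠ s₂ in (atTop : Filter ℝ), |g (s₂ • u) - g (s • u)| ≤ Φ s := by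
    filter_upwards [eventually_ge_atTop (s : ℝ)] with s₂ hs₂
    exact (hray s s₂ hs hs₂).trans (sub_le_self _ (hΦ0 _ (hs.trans hs₂)))
  have hlim : Tendsto (fun s₂ : ℝ => |g (s₂ • u) - g (s • u)|) atTop (𝓝 |A - g (s • u)|) :=
    ((hgt.sub tendsto_const_nhds).abs)
  have h := le_of_tendsto hlim hev
  rwa [abs_sub_comm] at h

/-! ## Independence of the direction -/

/-- On the segment from `s u` to `s v` (`‖u‖ = ‖v‖ = 1`, `⟪u, v⟫ ≥ 0`, `s ≥ 0`) every point
has norm at least `s/2` (`‖pu + qv‖² = p² + q² + 2pq⟪u,v⟫ ≥ p² + q² ≥ 1/2` for `p + q = 1`). [folklore] -/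
theorem half_le_norm_of_mem_segment {u v : (EuclideanSpace ℝ (Fin 3))} (hu : ‖u‖ = 1) (hv : ‖v‖ = 1) (huv : 0 ≤ ⟪u, v⟫)
    {s : ℝ} (hs : 0 ≤ s) {z : (EuclideanSpace ℝ (Fin 3))} (hz : z ∈ segment ℝ (s • u) (s • v)) : s / 2 ≤ ‖z‖ := by
  obtain ⟨p, q, hp, hq, hpq, rfl⟩ := hz
  have hfac : p • s • u + q • s • v = s • (p • u + q • v) := by
    rw [smul_comm p s u, smul_comm q s v, smul_add]
  have hX : 1 / 2 ≤ ‖p • u + q • v‖ := by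
    have hsq : ‖p • u + q • v‖ ^ 2 = p ^ 2 + 2 * (p * q * ⟪u, v⟫) + q ^ 2 := by
      rw [norm_add_sq_real, norm_smul, norm_smul, real_inner_smul_left, real_inner_smul_right, hu, hv,
        Real.norm_of_nonneg hp, Real.norm_of_nonneg hq]
      ring
    have h1 : 1 / 4 ≤ ‖p • u + q • v‖ ^ 2 := by
      rw [hsq]
      nlinarith [sq_nonneg (p - q), mul_nonneg (mul_nonneg hp hq) huv]
    nlinarith [norm_nonneg (p • u + q • v)]
  rw [hfac, norm_smul, Real.norm_of_nonneg hs]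
  nlinarith

/-- **Two rays at an angle `≤ π/2` have the same limit**: for unit `u, v` with `⟪u, v⟫ ≥ 0`,
`g(sv) - g(su) → 0` (mean value inequality on the segment `[su, sv]`, where `‖∇g‖ ≤ 8L/s³`, of
length `≤ 2s`). [folklore] -/
theorem tendsto_sub_of_inner_nonneg (hg : Differentiable ℝ g) (hL : 0 ≤ L) (ha : 0 < a)
    (hgrad : ∀ y : (EuclideanSpace ℝ (Fin 3)), ‖fderiv ℝ g y‖ ≤ L / (‖y‖ + a) ^ 3) {u v : (EuclideanSpace ℝ (Fin 3))} (hu : ‖u‖ = 1) (hv : ‖v‖ = 1)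
    (huv : 0 ≤ ⟪u, v⟫) : Tendsto (fun s : ℝ => g (s • v) - g (s • u)) atTop (𝓝 0) := by
  have hbd : ∀ s : ℝ, 0 < s → |g (s • v) - g (s • u)| ≤ 16 * L / s ^ 2 := by
    intro s hs
    have hseg : ∀ z ∈ segment ℝ (s • u) (s • v), ‖fderiv ℝ g z‖ ≤ L / (s / 2) ^ 3 := by
      intro z hz
      have hz' := half_le_norm_of_mem_segment hu hv huv hs.le hz
      refine (hgrad z).trans (div_le_div_of_nonneg_left hL (by positivity) ?_)
      exact pow_le_pow_left₀ (by positivity) (by linarith) 3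
    have hmvt := (convex_segment (s • u) (s • v)).norm_image_sub_le_of_norm_fderiv_le
      (fun z _ => (hg z)) hseg (left_mem_segment ℝ _ _) (right_mem_segment ℝ _ _)
    rw [Real.norm_eq_abs] at hmvt
    refine hmvt.trans ?_
    have hlen : ‖s • v - s • u‖ ≤ 2 * s := by
      calc ‖s • v - s • u‖ ≤ ‖s • v‖ + ‖s • u‖ := norm_sub_le _ _
        _ = 2 * s := by rw [norm_smul, norm_smul, hu, hv, Real.norm_of_nonneg hs.le]; ring
    calc L / (s / 2) ^ 3 * ‖s • v - s • u‖ ≤ L / (s / 2) ^ 3 * (2 * s) :=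
          mul_le_mul_of_nonneg_left hlen (by positivity)
      _ = 16 * L / s ^ 2 := by field_simp; ring
  have hmaj : Tendsto (fun s : ℝ => 16 * L / s ^ 2) atTop (𝓝 0) :=
    tendsto_const_nhds.div_atTop (tendsto_pow_atTop two_ne_zero)
  refine squeeze_zero_norm' ?_ hmaj
  filter_upwards [eventually_gt_atTop (0 : ℝ)] with s hs
  rw [Real.norm_eq_abs]
  exact hbd s hs

/-- Ray limits agree for unit directions with `u + v ≠ 0`: pass through the bisector
`m = (u+v)/‖u+v‖`, which makes an angle `≤ π/2` with both. [folklore] -/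
theorem ray_limit_eq_of_add_ne_zero (hg : Differentiable ℝ g) (hL : 0 ≤ L) (ha : 0 < a)
    (hgrad : ∀ y : (EuclideanSpace ℝ (Fin 3)), ‖fderiv ℝ g y‖ ≤ L / (‖y‖ + a) ^ 3) {u v : (EuclideanSpace ℝ (Fin 3))} (hu : ‖u‖ = 1) (hv : ‖v‖ = 1)
    (huv : u + v ≠ 0) {Au Av : ℝ} (hAu : Tendsto (fun s : ℝ => g (s • u)) atTop (𝓝 Au))
    (hAv : Tendsto (fun s : ℝ => g (s • v)) atTop (𝓝 Av)) : Au = Av := by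
  set m : (EuclideanSpace ℝ (Fin 3)) := ‖u + v‖⁻¹ • (u + v) with hm
  have hn : 0 < ‖u + v‖ := norm_pos_iff.2 huv
  have hmn : ‖m‖ = 1 := by rw [hm, norm_smul, norm_inv, norm_norm, inv_mul_cancel₀ hn.ne']
  have huv1 : -1 ≤ ⟪u, v⟫ := by
    have := abs_real_inner_le_norm u v
    rw [hu, hv, mul_one] at this
    linarith [neg_abs_le ⟪u, v⟫]
  have hum : 0 ≤ ⟪u, m⟫ := by
    rw [hm, real_inner_smul_right, inner_add_right, real_inner_self_eq_norm_sq, hu]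
    exact mul_nonneg (inv_nonneg.2 hn.le) (by linarith)
  have hvm : 0 ≤ ⟪v, m⟫ := by
    rw [hm, real_inner_smul_right, inner_add_right, real_inner_self_eq_norm_sq, hv, real_inner_comm]
    exact mul_nonneg (inv_nonneg.2 hn.le) (by linarith)
  obtain ⟨Am, hAm, -⟩ := exists_ray_limit hg hL ha hgrad hmn
  have h1 := tendsto_sub_of_inner_nonneg hg hL ha hgrad hu hmn hum
  have h2 := tendsto_sub_of_inner_nonneg hg hL ha hgrad hv hmn hvm
  have e1 : Am - Au = 0 := tendsto_nhds_unique (hAm.sub hAu) h1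
  have e2 : Am - Av = 0 := tendsto_nhds_unique (hAm.sub hAv) h2
  linarith

/-- **The limit at spatial infinity with a quadratic rate.** If `g : ℝ³ → ℝ` is differentiable
with `‖∇g(y)‖ ≤ L/(‖y‖+a)³`, `L ≥ 0`, `a > 0`, there is `A` with `|g(x) - A| ≤ L/(2(‖x‖+a)²)`
for all `x` (ray limits through `x/‖x‖`, all equal: non-antipodal directions by
`ray_limit_eq_of_add_ne_zero`, antipodal ones through a third direction). [folklore] -/
theorem exists_limit_of_norm_fderiv_le (hg : Differentiable ℝ g) (hL : 0 ≤ L) (ha : 0 < a)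
    (hgrad : ∀ y : (EuclideanSpace ℝ (Fin 3)), ‖fderiv ℝ g y‖ ≤ L / (‖y‖ + a) ^ 3) :
    ∃ A : ℝ, ∀ x : (EuclideanSpace ℝ (Fin 3)), |g x - A| ≤ L / (2 * (‖x‖ + a) ^ 2) := by
  -- two fixed orthogonal unit directions
  set b : OrthonormalBasis (Fin 3) ℝ (EuclideanSpace ℝ (Fin 3)) := EuclideanSpace.basisFun (Fin 3) ℝ with hb
  set e₀ : (EuclideanSpace ℝ (Fin 3)) := b 0 with he₀
  set e₁ : (EuclideanSpace ℝ (Fin 3)) := b 1 with he₁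
  have he₀n : ‖e₀‖ = 1 := b.orthonormal.1 0
  have he₁n : ‖e₁‖ = 1 := b.orthonormal.1 1
  have h01 : ⟪e₀, e₁⟫ = (0 : ℝ) := b.orthonormal.2 (by decide)
  obtain ⟨A, hA, hArate⟩ := exists_ray_limit hg hL ha hgrad he₀n
  obtain ⟨A₁, hA₁, -⟩ := exists_ray_limit hg hL ha hgrad he₁n
  refine ⟨A, fun x => ?_⟩
  rcases eq_or_ne x 0 with hx | hx
  · -- the origin lies on every ray
    have h := hArate 0 le_rfl
    rw [zero_smul] at h
    rw [hx, norm_zero, zero_add]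
    simpa using h
  -- the unit direction of `x`
  set w : (EuclideanSpace ℝ (Fin 3)) := ‖x‖⁻¹ • x with hw
  have hxn : 0 < ‖x‖ := norm_pos_iff.2 hx
  have hwn : ‖w‖ = 1 := by rw [hw, norm_smul, norm_inv, norm_norm, inv_mul_cancel₀ hxn.ne']
  have hxw : x = ‖x‖ • w := by rw [hw, smul_smul, mul_inv_cancel₀ hxn.ne', one_smul]
  obtain ⟨Aw, hAw, hAwrate⟩ := exists_ray_limit hg hL ha hgrad hwn
  -- `Aw = A`
  have hAwA : Aw = A := by
    by_cases hsum : w + e₀ ≠ 0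
    · exact ray_limit_eq_of_add_ne_zero hg hL ha hgrad hwn he₀n hsum hAw hA
    · -- antipodal: `w = -e₀`; go through `e₁`
      rw [not_ne_iff] at hsum
      have hwe : w = -e₀ := eq_neg_of_add_eq_zero_left hsum
      have h1 : w + e₁ ≠ 0 := by
        intro h
        have : ⟪w + e₁, e₁⟫ = (0 : ℝ) := by rw [h, inner_zero_left]
        rw [inner_add_left, hwe, inner_neg_left, h01, real_inner_self_eq_norm_sq, he₁n] at this
        norm_num at this
      have h2 : e₁ + e₀ ≠ 0 := by
        intro h
        have : ⟪e₁ + e₀, e₀⟫ = (0 : ℝ) := by rw [h, inner_zero_left]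
        rw [inner_add_left, real_inner_comm, h01, real_inner_self_eq_norm_sq, he₀n] at this
        norm_num at this
      exact (ray_limit_eq_of_add_ne_zero hg hL ha hgrad hwn he₁n h1 hAw hA₁).trans
        (ray_limit_eq_of_add_ne_zero hg hL ha hgrad he₁n he₀n h2 hA₁ hA)
  have h := hAwrate ‖x‖ hxn.le
  rw [← hxw, hAwA] at h
  exact h

end Gauge

/-! ## Registered sub-goal (helper stub of `stub_apexDerivativeBounds`) -/

/-- **Registered helper stub `stub_apexSpatialLimit`** (sub-goal of `stub_apexDerivativeBounds`,
crux stmt-NavierStokesRegularity-11717): a differentiable function on `ℝ³` whose gradient decays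
like `L/(‖y‖+a)³` has a limit `A` at spatial infinity with `|g(x) - A| ≤ L/(2(‖x‖+a)²)`.
[folklore] -/
theorem stub_apexSpatialLimit :
    ∀ (g : EuclideanSpace ℝ (Fin 3) → ℝ) (L a : ℝ), Differentiable ℝ g → 0 ≤ L → 0 < a →
      (∀ y : EuclideanSpace ℝ (Fin 3), ‖fderiv ℝ g y‖ ≤ L / (‖y‖ + a) ^ 3) →
      ∃ A : ℝ, ∀ x : EuclideanSpace ℝ (Fin 3), |g x - A| ≤ L / (2 * (‖x‖ + a) ^ 2) :=
  fun _ _ _ hg hL ha hgrad => exists_limit_of_norm_fderiv_le hg hL ha hgrad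

end Summit.NavierStokesRegularity.NavierStokesRegularity.Theorems.RellichScarScarRigidity

end
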